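import Summits.ABC.IUTFork.Conditional.WRowHexLamSevenAllKEventuallySharp
import Summits.ABC.IUTFork.Conditional.WRowHexLamSevenAllKNonCyclotomic
import Summits.ABC.IUTFork.Conditional.WRowLicenceTripleEventuallySharpM
import HarnessLib

/-!
# Branch C / R-W, reading (U), M line: the M-SETTING twins of the HEX family's k-UNIFORM kernel INHABITED theorems (abc-iut-C-cert-1 g9:
# `WRow.licence_lamSeven_allK_of_sq_lt` / `_of_primePow_lt` / `_sharp` / `_nonCyclotomic`, `λ_k = 1/2 + 2/7^k` for EVERY k ≥ 1)
# (abc-iut cell, branch C, row «C:INH-M-TWIN-RESIDUE» item (e); seat abc-iut-C-cert-2 gen 8; C LEAD KEY 2026-08-27T13:11Z)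

Record-only PROOF file (D-0012; 0 definitions, 0 `Prop` facts, nothing re-typed) of the abc-iut cell. TAKES NO SIDE on [IUTchIII] Cor. 3.12
(S. Mochizuki, *Inter-universal Teichmüller theory III*, Cor. 3.12 p. 173–174; Step (xi-f) p. 184) or on any author; «inhabited as typed» ≠
«asserted in print».

abc-iut-C-cert-1 g9's k-uniform HEX theorems are instances, at the triple `(7^k − 4) + 8 = 7^k + 4` written `(7^k + 4)·(7^k − 4)·(2·7^k)`
(`isABCTriple_hexK`, `lamSeven_eq_hexK`, `jInv_hexK_ne`), of abc-iut-C-cert-2 gen 6/7's generic K theorems `WRow.licence_triple_of_sq_lt` /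
`WRow.licence_triple_of_primePow_lt` (p508140 family) and `WRow.licence_orbit_of_nonCyclotomic` (p527747) — each of which has its M twin in the
tree already (gen-7 B2 `WRowM.licence_triple_of_primePow_lt` / `WRowM.licence_triple_of_sq_lt`, p520076; `WRowM.licence_orbit_of_nonCyclotomic`,
p527747). THIS FILE is the four «wrappers» (≤ 4 proof lines each, the K file's lines with the M theorem name): binders VERBATIM, conclusion =
`Thm311ToCor312.Licence` at the M-LEVEL setting of the datum's own ideles `settingPrVolSharpM T.D hlog (tOfIdeleData T.D r) (tqM … r …) …` (every
idele datum `r`, every analytic `logvK`, any `htq0/Sq/htq1`) — so the M books' (U) binder reads INHABITED AS TYPED, uniformly in k, on the same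
eventual / sharp / non-cyclotomic level ranges of every HEX axis as the K books'.

* `WRowM.licence_lamSeven_allK_of_sq_lt` (16·abc_k < l²) · `WRowM.licence_lamSeven_allK_of_primePow_lt` (per-prime sharp form) ·
  `WRowM.licence_lamSeven_allK_sharp` (l > 7, 4·7^{⌊k/2⌋} < l, odd bad primes split off) · `WRowM.licence_lamSeven_allK_nonCyclotomic` (every
  non-cyclotomic level).

HONEST SCOPE: OUR sharp containers and Dupuy–Hilado's typed (Ind1)/(Ind2); STRONGER-THAN-PRINT hull reading; a socket discharges nothing;
non-emptiness of the datum type, admissibility and Szpiro-badness NOT claimed; explicit hypothesis counts of the record books UNCHANGED; an M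
twin changes NO K-line census count; nothing about the printed GLOBAL inequality or the number-level corollary; typed ≠ proved; instantiated ≠
endorsed; no abc claim. [cite: Mochizuki2012, IUTchI Def. 3.1 (b),(c) pp. 61–62, Ex. 3.2 (iv) p. 71; IUTchIII Cor. 3.12 Step (xi-f) p. 184;
IUTchIV Prop. 1.1 p. 9, Prop. 1.2 (i)(ii) p. 10, Prop. 1.4 (ii) p. 13, Cor. 2.2 (ii) proof (P5) p. 46] [cite: DupuyHilado2025, §3.3, §3.4, §4.9, §4.12]
[claim: Mochizuki2012, status: disputed] for every IUT sentence. PROOF-ONLY: no definitions.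
-/

noncomputable section

open Set Function Metric NumberField IsDedekindDomain

namespace Summit.ABC.IUTFork.Conditional

open Thm311 Thm311.Real Cor312 Cor312Vol Cor312Prov Literature.IUT.LogThetaLattice Literature.IUT.LogVolume
  Literature.IUT.HodgeTheaters Literature.IUT.LogVolume.Cor22
open Literature.NumberTheory.NumberFields Literature.NumberTheory.GaloisRepresentations.Ultrametric
open Literature.NumberTheory.DiophantineGeometry Literature.NumberTheory.DiophantineGeometry.GenEll

/-- **M TWIN of `WRow.licence_lamSeven_allK_of_sq_lt`** (`WRowHexLamSevenAllKEventually`; binders `{k l : ℕ} (hk : 1 ≤ k) (hl : l.Prime) (hbig : 16 * ((7 ^ k + 4) * (7 ^ k - 4) * (2 * 7 ^ k)) < l ^ 2)` VERBATIM): for EVERY `k ≥ 1`, EVERY genuine Θ-volume datum `T` at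
`(ratPoint (1/2 + 2/7^k), l)` in the stated level range and EVERY idele datum `r` of `T.D`, `Thm311ToCor312.Licence` at
`settingPrVolSharpM T.D hlog (tOfIdeleData T.D r) (tqM … r …) …` — «wrapper»: gen-7 B2 `WRowM.licence_triple_of_sq_lt` (p520076) at `isABCTriple_hexK` / `jInv_hexK_ne` after `lamSeven_eq_hexK`. The M books' (U) binder is INHABITED AS TYPED there.
[cite: Mochizuki2012, IUTchIII Cor. 3.12 Step (xi-f) p. 184; IUTchIV Prop. 1.2 (i)(ii) p. 10, Cor. 2.2 (ii) proof (P5) p. 46] [cite: DupuyHilado2025, §3.3, §3.4, §4.9, §4.12]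
[claim: Mochizuki2012, status: disputed] -/
theorem WRowM.licence_lamSeven_allK_of_sq_lt_M {k l : ℕ} (hk : 1 ≤ k) (hl : l.Prime)
    (hbig : 16 * ((7 ^ k + 4) * (7 ^ k - 4) * (2 * 7 ^ k)) < l ^ 2)
    (T : Cor22.ThetaVolumeDatumAt (ratPoint ((2 : ℚ)⁻¹ + 2 / 7 ^ k)) l) :
    letI := T.instFieldF; letI := T.instNumberFieldF; letI := T.instAlgebraF; letI := T.instFieldK
    letI := T.instNumberFieldK; letI := T.instAlgebraK; letI := T.instFieldFbar; letI := T.instAlgebraFbar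
    letI := T.instAlgebraKFbar; letI := T.instIsElliptic
    ∀ {logvK : PadicLogsVal T.K} (hlog : LogvAnalyticVal logvK) (r : ThetaData.IdeleData T.D) (M : Type) [Field M] [NumberField M]
      (archPk : ∀ (j : (thetaIndexOfInitial T.D).Label) (vQ : (thetaIndexOfInitial T.D).VQ),
        Set ((logShellsOfInitialDH T.D logvK).Packet j vQ))
      (archSub : ∀ (j : (thetaIndexOfInitial T.D).Label) (v : (thetaIndexOfInitial T.D).V),
        Set ((logShellsOfInitialDH T.D logvK).Packet j ((thetaIndexOfInitial T.D).over v)))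
      (Ψ : ℤ → ∀ v : (thetaIndexOfInitial T.D).V, v ∈ (thetaIndexOfInitial T.D).Vbad →
        Set ((logShellsOfInitialDH T.D logvK).StarPacket v))
      (act : ℤ → ∀ v : (thetaIndexOfInitial T.D).V, v ∈ (thetaIndexOfInitial T.D).Vbad →
        (logShellsOfInitialDH T.D logvK).StarPacket v → Module.End ℚ ((logShellsOfInitialDH T.D logvK).StarPacket v))
      (Mmod : ℤ → ∀ j : (thetaIndexOfInitial T.D).LabelStar, Set ((logShellsOfInitialDH T.D logvK).GlobalPacket j.1))
      (region : ℤ → ∀ j : (thetaIndexOfInitial T.D).LabelStar, FinDivisor M → ∀ vQ : (thetaIndexOfInitial T.D).VQ,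
        Set ((logShellsOfInitialDH T.D logvK).Packet j.1 vQ))
      (n : ℤ) {HT : Type} {LogLink : HT → HT → Type} {IsFull : ∀ {s t : HT}, LogLink s t → Prop}
      (lat : LGPGaussianLogThetaLattice LogLink IsFull)
      {Frd : Type} {IsoF : Frd → Frd → Type} {Ob : Frd → Type} {realify : Frd → Frd} {Strip : Type}
      {IsoS : Strip → Strip → Type}
      {Mv : ∀ v : (thetaIndexOfInitial T.D).V, v ∈ (thetaIndexOfInitial T.D).Vbad → Type} [∀ v h, Monoid (Mv v h)]
      (sig : GlobalLGPFrobenioidSignature (thetaIndexOfInitial T.D).lstar (thetaIndexOfInitial T.D).V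
        (· ∈ (thetaIndexOfInitial T.D).Vbad) Frd IsoF Ob realify Strip IsoS Mv)
      (split : SplittingMonoids Mv) {ObΔ : Type}
      {N : ∀ v : (thetaIndexOfInitial T.D).V, v ∈ (thetaIndexOfInitial T.D).Vbad → Type} [∀ v h, Monoid (N v h)]
      (qData : QPilotData ObΔ N)
      (htq0 : ∀ (u : FinitePlace ℚ) (x : (thetaIndexOfInitial T.D).Fibre (Val.non u)),
        tqM T.D (ratChar u) u (natCast_ratChar_mem u) r x ≠ 0)
      (Sq : Finset (FinitePlace ℚ))
      (htq1 : ∀ (u : FinitePlace ℚ) (x : (thetaIndexOfInitial T.D).Fibre (Val.non u)), u ∉ Sq →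
        ‖tqM T.D (ratChar u) u (natCast_ratChar_mem u) r x‖ = 1),
      Thm311ToCor312.Licence
        (settingPrVolSharpM T.D hlog (tOfIdeleData T.D r) (fun u x => tqM T.D (ratChar u) u (natCast_ratChar_mem u) r x) M archPk
          archSub Ψ act Mmod region n lat sig split qData htq0 Sq htq1) := by
  revert T
  rw [lamSeven_eq_hexK k]
  intro T
  exact WRowM.licence_triple_of_sq_lt (isABCTriple_hexK hk) (jInv_hexK_ne hk) hl hbig T

/-- **M TWIN of `WRow.licence_lamSeven_allK_of_primePow_lt`** (`WRowHexLamSevenAllKEventuallySharp`; binders `{k l : ℕ} (hk : 1 ≤ k) (hl : l.Prime) (hl5 : 5 ≤ l) (hbad : ∀ p : ℕ, p.Prime → p ∣ (7 ^ k + 4) * (7 ^ k - 4) * (2 * 7 ^ k) → p ≠ 2 → p < l ∧ 4 * p ^ (((7 ^ k + 4) * (7 ^ k - 4) * (2 * 7 ^ k)).factorization p / 2) < l)` VERBATIM): for EVERY `k ≥ 1`, EVERY genuine Θ-volume datum `T` at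
`(ratPoint (1/2 + 2/7^k), l)` in the stated level range and EVERY idele datum `r` of `T.D`, `Thm311ToCor312.Licence` at
`settingPrVolSharpM T.D hlog (tOfIdeleData T.D r) (tqM … r …) …` — «wrapper»: gen-7 B2 `WRowM.licence_triple_of_primePow_lt` (p520076) at `isABCTriple_hexK` / `jInv_hexK_ne` after `lamSeven_eq_hexK`. The M books' (U) binder is INHABITED AS TYPED there.
[cite: Mochizuki2012, IUTchIII Cor. 3.12 Step (xi-f) p. 184; IUTchIV Prop. 1.2 (i)(ii) p. 10, Cor. 2.2 (ii) proof (P5) p. 46] [cite: DupuyHilado2025, §3.3, §3.4, §4.9, §4.12]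
[claim: Mochizuki2012, status: disputed] -/
theorem WRowM.licence_lamSeven_allK_of_primePow_lt_M {k l : ℕ} (hk : 1 ≤ k) (hl : l.Prime) (hl5 : 5 ≤ l)
    (hbad : ∀ p : ℕ, p.Prime → p ∣ (7 ^ k + 4) * (7 ^ k - 4) * (2 * 7 ^ k) → p ≠ 2 →
      p < l ∧ 4 * p ^ (((7 ^ k + 4) * (7 ^ k - 4) * (2 * 7 ^ k)).factorization p / 2) < l)
    (T : Cor22.ThetaVolumeDatumAt (ratPoint ((2 : ℚ)⁻¹ + 2 / 7 ^ k)) l) :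
    letI := T.instFieldF; letI := T.instNumberFieldF; letI := T.instAlgebraF; letI := T.instFieldK
    letI := T.instNumberFieldK; letI := T.instAlgebraK; letI := T.instFieldFbar; letI := T.instAlgebraFbar
    letI := T.instAlgebraKFbar; letI := T.instIsElliptic
    ∀ {logvK : PadicLogsVal T.K} (hlog : LogvAnalyticVal logvK) (r : ThetaData.IdeleData T.D) (M : Type) [Field M] [NumberField M]
      (archPk : ∀ (j : (thetaIndexOfInitial T.D).Label) (vQ : (thetaIndexOfInitial T.D).VQ),
        Set ((logShellsOfInitialDH T.D logvK).Packet j vQ))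
      (archSub : ∀ (j : (thetaIndexOfInitial T.D).Label) (v : (thetaIndexOfInitial T.D).V),
        Set ((logShellsOfInitialDH T.D logvK).Packet j ((thetaIndexOfInitial T.D).over v)))
      (Ψ : ℤ → ∀ v : (thetaIndexOfInitial T.D).V, v ∈ (thetaIndexOfInitial T.D).Vbad →
        Set ((logShellsOfInitialDH T.D logvK).StarPacket v))
      (act : ℤ → ∀ v : (thetaIndexOfInitial T.D).V, v ∈ (thetaIndexOfInitial T.D).Vbad →
        (logShellsOfInitialDH T.D logvK).StarPacket v → Module.End ℚ ((logShellsOfInitialDH T.D logvK).StarPacket v))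
      (Mmod : ℤ → ∀ j : (thetaIndexOfInitial T.D).LabelStar, Set ((logShellsOfInitialDH T.D logvK).GlobalPacket j.1))
      (region : ℤ → ∀ j : (thetaIndexOfInitial T.D).LabelStar, FinDivisor M → ∀ vQ : (thetaIndexOfInitial T.D).VQ,
        Set ((logShellsOfInitialDH T.D logvK).Packet j.1 vQ))
      (n : ℤ) {HT : Type} {LogLink : HT → HT → Type} {IsFull : ∀ {s t : HT}, LogLink s t → Prop}
      (lat : LGPGaussianLogThetaLattice LogLink IsFull)
      {Frd : Type} {IsoF : Frd → Frd → Type} {Ob : Frd → Type} {realify : Frd → Frd} {Strip : Type}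
      {IsoS : Strip → Strip → Type}
      {Mv : ∀ v : (thetaIndexOfInitial T.D).V, v ∈ (thetaIndexOfInitial T.D).Vbad → Type} [∀ v h, Monoid (Mv v h)]
      (sig : GlobalLGPFrobenioidSignature (thetaIndexOfInitial T.D).lstar (thetaIndexOfInitial T.D).V
        (· ∈ (thetaIndexOfInitial T.D).Vbad) Frd IsoF Ob realify Strip IsoS Mv)
      (split : SplittingMonoids Mv) {ObΔ : Type}
      {N : ∀ v : (thetaIndexOfInitial T.D).V, v ∈ (thetaIndexOfInitial T.D).Vbad → Type} [∀ v h, Monoid (N v h)]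
      (qData : QPilotData ObΔ N)
      (htq0 : ∀ (u : FinitePlace ℚ) (x : (thetaIndexOfInitial T.D).Fibre (Val.non u)),
        tqM T.D (ratChar u) u (natCast_ratChar_mem u) r x ≠ 0)
      (Sq : Finset (FinitePlace ℚ))
      (htq1 : ∀ (u : FinitePlace ℚ) (x : (thetaIndexOfInitial T.D).Fibre (Val.non u)), u ∉ Sq →
        ‖tqM T.D (ratChar u) u (natCast_ratChar_mem u) r x‖ = 1),
      Thm311ToCor312.Licence
        (settingPrVolSharpM T.D hlog (tOfIdeleData T.D r) (fun u x => tqM T.D (ratChar u) u (natCast_ratChar_mem u) r x) M archPk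
          archSub Ψ act Mmod region n lat sig split qData htq0 Sq htq1) := by
  revert T
  rw [lamSeven_eq_hexK k]
  intro T
  exact WRowM.licence_triple_of_primePow_lt (isABCTriple_hexK hk) (jInv_hexK_ne hk) hl hl5 hbad T

/-- **M TWIN of `WRow.licence_lamSeven_allK_sharp`** (`WRowHexLamSevenAllKEventuallySharp`; binders `{k l : ℕ} (hk : 1 ≤ k) (hl : l.Prime) (h7l : 7 < l) (h7 : 4 * 7 ^ (k / 2) < l) (hodd : ∀ p : ℕ, p.Prime → p ∣ (7 ^ k + 4) * (7 ^ k - 4) → p < l ∧ 4 * p ^ (((7 ^ k + 4) * (7 ^ k - 4)).factorization p / 2) < l)` VERBATIM): for EVERY `k ≥ 1`, EVERY genuine Θ-volume datum `T` at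
`(ratPoint (1/2 + 2/7^k), l)` in the stated level range and EVERY idele datum `r` of `T.D`, `Thm311ToCor312.Licence` at
`settingPrVolSharpM T.D hlog (tOfIdeleData T.D r) (tqM … r …) …` — «wrapper»: the previous twin at abc-iut-C-cert-1's `hexK_bad_of_split` (the even prime and `7` split off) BY NAME. The M books' (U) binder is INHABITED AS TYPED there.
[cite: Mochizuki2012, IUTchIII Cor. 3.12 Step (xi-f) p. 184; IUTchIV Prop. 1.2 (i)(ii) p. 10, Cor. 2.2 (ii) proof (P5) p. 46] [cite: DupuyHilado2025, §3.3, §3.4, §4.9, §4.12]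
[claim: Mochizuki2012, status: disputed] -/
theorem WRowM.licence_lamSeven_allK_sharp_M {k l : ℕ} (hk : 1 ≤ k) (hl : l.Prime) (h7l : 7 < l) (h7 : 4 * 7 ^ (k / 2) < l)
    (hodd : ∀ p : ℕ, p.Prime → p ∣ (7 ^ k + 4) * (7 ^ k - 4) →
      p < l ∧ 4 * p ^ (((7 ^ k + 4) * (7 ^ k - 4)).factorization p / 2) < l)
    (T : Cor22.ThetaVolumeDatumAt (ratPoint ((2 : ℚ)⁻¹ + 2 / 7 ^ k)) l) :
    letI := T.instFieldF; letI := T.instNumberFieldF; letI := T.instAlgebraF; letI := T.instFieldK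
    letI := T.instNumberFieldK; letI := T.instAlgebraK; letI := T.instFieldFbar; letI := T.instAlgebraFbar
    letI := T.instAlgebraKFbar; letI := T.instIsElliptic
    ∀ {logvK : PadicLogsVal T.K} (hlog : LogvAnalyticVal logvK) (r : ThetaData.IdeleData T.D) (M : Type) [Field M] [NumberField M]
      (archPk : ∀ (j : (thetaIndexOfInitial T.D).Label) (vQ : (thetaIndexOfInitial T.D).VQ),
        Set ((logShellsOfInitialDH T.D logvK).Packet j vQ))
      (archSub : ∀ (j : (thetaIndexOfInitial T.D).Label) (v : (thetaIndexOfInitial T.D).V),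
        Set ((logShellsOfInitialDH T.D logvK).Packet j ((thetaIndexOfInitial T.D).over v)))
      (Ψ : ℤ → ∀ v : (thetaIndexOfInitial T.D).V, v ∈ (thetaIndexOfInitial T.D).Vbad →
        Set ((logShellsOfInitialDH T.D logvK).StarPacket v))
      (act : ℤ → ∀ v : (thetaIndexOfInitial T.D).V, v ∈ (thetaIndexOfInitial T.D).Vbad →
        (logShellsOfInitialDH T.D logvK).StarPacket v → Module.End ℚ ((logShellsOfInitialDH T.D logvK).StarPacket v))
      (Mmod : ℤ → ∀ j : (thetaIndexOfInitial T.D).LabelStar, Set ((logShellsOfInitialDH T.D logvK).GlobalPacket j.1))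
      (region : ℤ → ∀ j : (thetaIndexOfInitial T.D).LabelStar, FinDivisor M → ∀ vQ : (thetaIndexOfInitial T.D).VQ,
        Set ((logShellsOfInitialDH T.D logvK).Packet j.1 vQ))
      (n : ℤ) {HT : Type} {LogLink : HT → HT → Type} {IsFull : ∀ {s t : HT}, LogLink s t → Prop}
      (lat : LGPGaussianLogThetaLattice LogLink IsFull)
      {Frd : Type} {IsoF : Frd → Frd → Type} {Ob : Frd → Type} {realify : Frd → Frd} {Strip : Type}
      {IsoS : Strip → Strip → Type}
      {Mv : ∀ v : (thetaIndexOfInitial T.D).V, v ∈ (thetaIndexOfInitial T.D).Vbad → Type} [∀ v h, Monoid (Mv v h)]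
      (sig : GlobalLGPFrobenioidSignature (thetaIndexOfInitial T.D).lstar (thetaIndexOfInitial T.D).V
        (· ∈ (thetaIndexOfInitial T.D).Vbad) Frd IsoF Ob realify Strip IsoS Mv)
      (split : SplittingMonoids Mv) {ObΔ : Type}
      {N : ∀ v : (thetaIndexOfInitial T.D).V, v ∈ (thetaIndexOfInitial T.D).Vbad → Type} [∀ v h, Monoid (N v h)]
      (qData : QPilotData ObΔ N)
      (htq0 : ∀ (u : FinitePlace ℚ) (x : (thetaIndexOfInitial T.D).Fibre (Val.non u)),
        tqM T.D (ratChar u) u (natCast_ratChar_mem u) r x ≠ 0)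
      (Sq : Finset (FinitePlace ℚ))
      (htq1 : ∀ (u : FinitePlace ℚ) (x : (thetaIndexOfInitial T.D).Fibre (Val.non u)), u ∉ Sq →
        ‖tqM T.D (ratChar u) u (natCast_ratChar_mem u) r x‖ = 1),
      Thm311ToCor312.Licence
        (settingPrVolSharpM T.D hlog (tOfIdeleData T.D r) (fun u x => tqM T.D (ratChar u) u (natCast_ratChar_mem u) r x) M archPk
          archSub Ψ act Mmod region n lat sig split qData htq0 Sq htq1) := by
  exact WRowM.licence_lamSeven_allK_of_primePow_lt_M hk hl (by omega) (hexK_bad_of_split hk h7l h7 hodd) T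

/-- **M TWIN of `WRow.licence_lamSeven_allK_nonCyclotomic`** (`WRowHexLamSevenAllKNonCyclotomic`; binders `{k l : ℕ} (hk : 1 ≤ k) (hl : l.Prime) (hl5 : 5 ≤ l) (hnc : ∀ p : ℕ, p.Prime → p ∣ (7 ^ k + 4) * (7 ^ k - 4) * (2 * 7 ^ k) → p ≠ 2 → p ≠ l ∧ ¬ l ∣ p - 1 ∧ (((7 ^ k + 4) * (7 ^ k - 4) * (2 * 7 ^ k)).factorization p < 2 ∨ 4 * p ^ (((7 ^ k + 4) * (7 ^ k - 4) * (2 * 7 ^ k)).factorization p / 2) < l))` VERBATIM): for EVERY `k ≥ 1`, EVERY genuine Θ-volume datum `T` at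
`(ratPoint (1/2 + 2/7^k), l)` in the stated level range and EVERY idele datum `r` of `T.D`, `Thm311ToCor312.Licence` at
`settingPrVolSharpM T.D hlog (tOfIdeleData T.D r) (tqM … r …) …` — «wrapper»: gen-7 `WRowM.licence_orbit_of_nonCyclotomic` (p527747) at the orbit point `1/2 + 2/7^k` of the hexK triple. The M books' (U) binder is INHABITED AS TYPED there.
[cite: Mochizuki2012, IUTchIII Cor. 3.12 Step (xi-f) p. 184; IUTchIV Prop. 1.2 (i)(ii) p. 10, Cor. 2.2 (ii) proof (P5) p. 46] [cite: DupuyHilado2025, §3.3, §3.4, §4.9, §4.12]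
[claim: Mochizuki2012, status: disputed] -/
theorem WRowM.licence_lamSeven_allK_nonCyclotomic_M {k l : ℕ} (hk : 1 ≤ k) (hl : l.Prime) (hl5 : 5 ≤ l)
    (hnc : ∀ p : ℕ, p.Prime → p ∣ (7 ^ k + 4) * (7 ^ k - 4) * (2 * 7 ^ k) → p ≠ 2 →
      p ≠ l ∧ ¬ l ∣ p - 1 ∧ (((7 ^ k + 4) * (7 ^ k - 4) * (2 * 7 ^ k)).factorization p < 2 ∨ 4 * p ^ (((7 ^ k + 4) * (7 ^ k - 4) * (2 * 7 ^ k)).factorization p / 2) < l))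
    (T : Cor22.ThetaVolumeDatumAt (ratPoint ((2 : ℚ)⁻¹ + 2 / 7 ^ k)) l) :
    letI := T.instFieldF; letI := T.instNumberFieldF; letI := T.instAlgebraF; letI := T.instFieldK
    letI := T.instNumberFieldK; letI := T.instAlgebraK; letI := T.instFieldFbar; letI := T.instAlgebraFbar
    letI := T.instAlgebraKFbar; letI := T.instIsElliptic
    ∀ {logvK : PadicLogsVal T.K} (hlog : LogvAnalyticVal logvK) (r : ThetaData.IdeleData T.D) (M : Type) [Field M] [NumberField M]
      (archPk : ∀ (j : (thetaIndexOfInitial T.D).Label) (vQ : (thetaIndexOfInitial T.D).VQ),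
        Set ((logShellsOfInitialDH T.D logvK).Packet j vQ))
      (archSub : ∀ (j : (thetaIndexOfInitial T.D).Label) (v : (thetaIndexOfInitial T.D).V),
        Set ((logShellsOfInitialDH T.D logvK).Packet j ((thetaIndexOfInitial T.D).over v)))
      (Ψ : ℤ → ∀ v : (thetaIndexOfInitial T.D).V, v ∈ (thetaIndexOfInitial T.D).Vbad →
        Set ((logShellsOfInitialDH T.D logvK).StarPacket v))
      (act : ℤ → ∀ v : (thetaIndexOfInitial T.D).V, v ∈ (thetaIndexOfInitial T.D).Vbad →
        (logShellsOfInitialDH T.D logvK).StarPacket v → Module.End ℚ ((logShellsOfInitialDH T.D logvK).StarPacket v))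
      (Mmod : ℤ → ∀ j : (thetaIndexOfInitial T.D).LabelStar, Set ((logShellsOfInitialDH T.D logvK).GlobalPacket j.1))
      (region : ℤ → ∀ j : (thetaIndexOfInitial T.D).LabelStar, FinDivisor M → ∀ vQ : (thetaIndexOfInitial T.D).VQ,
        Set ((logShellsOfInitialDH T.D logvK).Packet j.1 vQ))
      (n : ℤ) {HT : Type} {LogLink : HT → HT → Type} {IsFull : ∀ {s t : HT}, LogLink s t → Prop}
      (lat : LGPGaussianLogThetaLattice LogLink IsFull)
      {Frd : Type} {IsoF : Frd → Frd → Type} {Ob : Frd → Type} {realify : Frd → Frd} {Strip : Type}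
      {IsoS : Strip → Strip → Type}
      {Mv : ∀ v : (thetaIndexOfInitial T.D).V, v ∈ (thetaIndexOfInitial T.D).Vbad → Type} [∀ v h, Monoid (Mv v h)]
      (sig : GlobalLGPFrobenioidSignature (thetaIndexOfInitial T.D).lstar (thetaIndexOfInitial T.D).V
        (· ∈ (thetaIndexOfInitial T.D).Vbad) Frd IsoF Ob realify Strip IsoS Mv)
      (split : SplittingMonoids Mv) {ObΔ : Type}
      {N : ∀ v : (thetaIndexOfInitial T.D).V, v ∈ (thetaIndexOfInitial T.D).Vbad → Type} [∀ v h, Monoid (N v h)]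
      (qData : QPilotData ObΔ N)
      (htq0 : ∀ (u : FinitePlace ℚ) (x : (thetaIndexOfInitial T.D).Fibre (Val.non u)),
        tqM T.D (ratChar u) u (natCast_ratChar_mem u) r x ≠ 0)
      (Sq : Finset (FinitePlace ℚ))
      (htq1 : ∀ (u : FinitePlace ℚ) (x : (thetaIndexOfInitial T.D).Fibre (Val.non u)), u ∉ Sq →
        ‖tqM T.D (ratChar u) u (natCast_ratChar_mem u) r x‖ = 1),
      Thm311ToCor312.Licence
        (settingPrVolSharpM T.D hlog (tOfIdeleData T.D r) (fun u x => tqM T.D (ratChar u) u (natCast_ratChar_mem u) r x) M archPk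
          archSub Ψ act Mmod region n lat sig split qData htq0 Sq htq1) := by
  exact WRowM.licence_orbit_of_nonCyclotomic (isABCTriple_hexK hk) (q := (2 : ℚ)⁻¹ + 2 / 7 ^ k) (by rw [lamSeven_eq_hexK k]) hl hl5 hnc T

end Summit.ABC.IUTFork.Conditional

end
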